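import Literature.NumberTheory.Transcendental.PhilipponCriterionFinal
import Literature.NumberTheory.Transcendental.PhilipponCriterion
import HarnessLib

/-!
# Philippon's criterion over Nesterenko's toolkit, XIX: the main criterion for `k < n` — proofs only

`Literature/NumberTheory/Transcendental/PhilipponCriterionMainLt.lean` — proofs only (no new
definitions, nothing asserted). Assembles the engine of files I–XVIII into the statement of
`Philippon1986_mainCriterion` (Publ. Math. IHÉS 64 (1986), Thm 2.11, in the transcendence-degree
form of Diaz 1989, see `PhilipponCriterion.lean`) in the case `k < n`, conditionally on the named
facts of LNM 1752 Ch. 3 §4 (Prop. 4.4, 4.7, Cor. 4.10, Prop. 4.11, Cor. 4.12, Prop. 4.13):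

* `mainCriterion_of_lt` — for `θ ∈ ℂⁿ` and `k < n` the constant `C = C(n, k, θ)` is chosen from the
  starting prime `𝔓₀ = 𝔭_{(1,θ)}` (its rank `r₀`, degree `D₀`, height `H₀`), the data of Thm 2.11
  are packaged into `Setup` (generators = homogenisations `ʰQ_{N,j}`, `exists_homogenization`), the
  level `N₁` comes from `σ + δ → ∞`, and `Setup.not_large` concludes.

The case `k = n` (where `𝔓₀` may be `(0)`) is reduced to this one in `PhilipponCriterionMain.lean`.

## References

* [Philippon1986Criteres] P. Philippon, Publ. Math. IHÉS 64 (1986), Thm 2.11 and §3 (pp. 38–48).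
* [Diaz1989] G. Diaz, J. Number Theory 31 (1989), Critère p. 16.
* [NesterenkoPhilippon2001] LNM 1752 (2001), Ch. 3 §4.
-/

noncomputable section

open MvPolynomial Real Filter
open Literature.NumberTheory.Transcendental.Nesterenko

attribute [local instance] MvPolynomial.gradedAlgebra

namespace Literature.NumberTheory.Transcendental

namespace PhilipponMain

/-! ### The standing data from the data of Thm 2.11 -/

/-- Height of a homogenisation: `h(ʰQ) ≤ log L(Q) ≤ s` (also for `Q = 0`, where `h ≤ log 0 = 0`).
[folklore] -/
theorem height_le_of_homogenization_spec {n : ℕ} {Q : MvPolynomial (Fin n) ℤ} {E : Rx n}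
    (hh : height E ≤ Real.log (mvPolyHeight Q)) {s : ℝ} (h1 : 1 ≤ s)
    (hl : Real.log (Chudnovsky.l1 Q) ≤ s) : height E ≤ s := by
  by_cases h0 : Q = 0
  · rw [h0, mvPolyHeight_zero, Nat.cast_zero, Real.log_zero] at hh
    linarith
  · exact (height_le_log_l1_of_homogenization h0 hh).trans hl

/-- Value of a homogenisation: `‖ʰQ‖_ω̄ ≤ |Q(θ)| ≤ e^{−S}` (also for `Q = 0`, where `|ʰQ| = 0`).
[folklore] -/
theorem normAt_le_of_homogenization_spec {n : ℕ} {Q : MvPolynomial (Fin n) ℤ} {E : Rx n}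
    (hval : ∀ ω : Fin (n + 1) → ℂ, ω 0 = 1 → aeval ω E = aeval (fun i : Fin n => ω i.succ) Q)
    (hmax : maxNorm E = (mvPolyHeight Q : ℝ)) {θ : Fin n → ℂ} {S : ℝ}
    (hsmall : ‖aeval θ Q‖ ≤ Real.exp (-S)) : normAt (Fin.cons 1 θ) E ≤ Real.exp (-S) := by
  by_cases h0 : Q = 0
  · rw [h0, mvPolyHeight_zero, Nat.cast_zero] at hmax
    rw [normAt, hmax, zero_mul, div_zero]
    exact (exp_pos _).le
  · exact normAt_le_exp_of_homogenization h0 hval hmax hsmall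

/-- **The standing data of §3** built from the data of Thm 2.11 (generators = homogenisations
`ʰQ_{N,j}`), with its constants `r₀, D₀, B_1, Θ` identified. [cite: Philippon1986Criteres, §3 p. 41] -/
theorem exists_setup {n k : ℕ} (θ : Fin n → ℂ) (hkn : k < n)
    (htr : Algebra.trdeg ℚ ↥(IntermediateField.adjoin ℚ (Set.range θ)) ≤ k) {C : ℝ} (hC : 1 ≤ C)
    (σ δ R S : ℕ → ℝ) (hσ : Monotone σ) (hδ : Monotone δ) (hR : Monotone R) (hS : Monotone S)
    (h1σ : ∀ N, 1 ≤ σ N) (h1δ : ∀ N, 1 ≤ δ N) (h1R : ∀ N, 1 ≤ R N) (h1S : ∀ N, 1 ≤ S N)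
    (hτ : Tendsto (fun N => σ N + δ N) atTop atTop)
    (hmono : Monotone (fun N => S N / ((σ N + δ N) * δ N ^ k)))
    (hgrowth : ∀ N, C * (σ (N + 1) + δ (N + 1)) * δ (N + 1) ^ k *
      (S N ^ (k + 1) + R (N + 1) ^ (k + 1)) ≤ S N ^ (k + 2))
    (N₀ : ℕ) (mN : ℕ → ℕ) (Q : (N : ℕ) → Fin (mN N) → MvPolynomial (Fin n) ℤ)
    (hQ : ∀ N, N₀ ≤ N →
      Set.Finite {z : Fin n → ℂ | (∀ i, ‖z i - θ i‖ ≤ Real.exp (-R N)) ∧ ∀ j, aeval z (Q N j) = 0} ∧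
      (∀ j, ((Q N j).totalDegree : ℝ) ≤ δ N) ∧
      (∀ j, Real.log (Chudnovsky.l1 (Q N j)) ≤ σ N) ∧
      (∃ j, aeval θ (Q N j) ≠ 0) ∧ (∀ j, ‖aeval θ (Q N j)‖ ≤ Real.exp (-S N))) :
    ∃ 𝒮 : Setup, 𝒮.m = n ∧ 𝒮.k = k ∧ 𝒮.C = C ∧ 𝒮.N₀ = N₀ ∧ 𝒮.R = R ∧
      (∀ N, 𝒮.τ N = σ N + δ N) ∧
      𝒮.r₀ = Classical.choose (exists_isUnmixedOfRank_coneIdeal θ htr) ∧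
      𝒮.D₀ = max (ideg (coneIdeal (Fin.cons 1 θ : Fin (n + 1) → ℂ))
        (Classical.choose (exists_isUnmixedOfRank_coneIdeal θ htr))) 1 ∧
      𝒮.H₀ = iheight (coneIdeal (Fin.cons 1 θ : Fin (n + 1) → ℂ))
        (Classical.choose (exists_isUnmixedOfRank_coneIdeal θ htr)) ∧
      𝒮.Θ = ‖(Fin.cons 1 θ : Fin (n + 1) → ℂ)‖ := by
  classical
  obtain ⟨E, hE⟩ : ∃ E : (N : ℕ) → Fin (mN N) → Rx n, ∀ N j,
      (E N j).IsHomogeneous (Q N j).totalDegree ∧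
      (∀ ω' : Fin (n + 1) → ℂ, ω' 0 = 1 →
        aeval ω' (E N j) = aeval (fun i : Fin n => ω' i.succ) (Q N j)) ∧
      maxNorm (E N j) = (mvPolyHeight (Q N j) : ℝ) ∧
      height (E N j) ≤ Real.log (mvPolyHeight (Q N j)) ∧ (Q N j ≠ 0 → E N j ≠ 0) :=
    ⟨fun N j => Classical.choose (exists_homogenization (Q N j)),
      fun N j => Classical.choose_spec (exists_homogenization (Q N j))⟩
  refine ⟨
    { m := n, k := k, θ := θ, σ := σ, δ := δ, R := R, S := S, C := C, N₀ := N₀, M := mN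
      E := E, d := fun N j => (Q N j).totalDegree
      one_le_m := by omega
      k_le_m := hkn.le
      one_le_C := hC
      mono_σ := hσ, mono_δ := hδ, mono_R := hR, mono_S := hS
      one_le_σ := h1σ, one_le_δ := h1δ, one_le_R := h1R, one_le_S := h1S
      tendsto_τ := hτ, mono_g := hmono, growth := hgrowth
      isHomogeneous_E := fun N j => (hE N j).1
      d_le := fun N hN j => (hQ N hN).2.1 j
      height_le := fun N hN j =>
        height_le_of_homogenization_spec (hE N j).2.2.2.1 (h1σ N) ((hQ N hN).2.2.1 j)
      normAt_le := fun N hN j =>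
        normAt_le_of_homogenization_spec (hE N j).2.1 (hE N j).2.2.1 ((hQ N hN).2.2.2.2 j)
      exists_not_mem := fun N hN => by
        obtain ⟨j, hj⟩ := (hQ N hN).2.2.2.1
        exact ⟨j, fun h =>
          hj ((mem_coneIdeal_iff_of_homogenization (hE N j).1 (hE N j).2.1 θ).mp h)⟩
      finite_zeros := fun N hN => by
        refine (hQ N hN).1.subset ?_
        rintro z ⟨h1, h2⟩
        exact ⟨h1, fun j => by rw [← aeval_cons_one_of_homogenization (hE N j).2.1 z]; exact h2 j⟩
      trdeg_le := htr }, rfl, rfl, rfl, rfl, rfl, fun N => rfl, rfl, rfl, rfl, rfl⟩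

/-! ### The main criterion for `k < n` -/

/-- **Philippon's main criterion, case `k < n`**, conditionally on the facts of LNM 1752 Ch. 3 §4.
[cite: Philippon1986Criteres, Théorème 2.11 (critère principal), pp. 38–39 and §3]
[cite: Diaz1989, Critère, p. 16] -/
theorem mainCriterion_of_lt (h44 : NesterenkoPhilippon2001_ch3_prop_4_4)
    (h47 : NesterenkoPhilippon2001_ch3_prop_4_7) (h410 : NesterenkoPhilippon2001_ch3_cor_4_10)
    (h411 : NesterenkoPhilippon2001_ch3_prop_4_11) (h412 : NesterenkoPhilippon2001_ch3_cor_4_12)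
    (h413 : NesterenkoPhilippon2001_ch3_prop_4_13) (n k : ℕ) (θ : Fin n → ℂ) (hkn : k < n) :
    ∃ C : ℝ, 1 ≤ C ∧
    ∀ (σ δ R S : ℕ → ℝ), Monotone σ → Monotone δ → Monotone R → Monotone S →
      (∀ N, 1 ≤ σ N) → (∀ N, 1 ≤ δ N) → (∀ N, 1 ≤ R N) → (∀ N, 1 ≤ S N) →
      Tendsto (fun N => σ N + δ N) atTop atTop →
      Monotone (fun N => S N / ((σ N + δ N) * δ N ^ k)) →
      (∀ N, C * (σ (N + 1) + δ (N + 1)) * δ (N + 1) ^ k * (S N ^ (k + 1) + R (N + 1) ^ (k + 1))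
          ≤ S N ^ (k + 2)) →
      ∀ (N₀ : ℕ) (m : ℕ → ℕ) (Q : (N : ℕ) → Fin (m N) → MvPolynomial (Fin n) ℤ),
        (∀ N, N₀ ≤ N →
          Set.Finite {z : Fin n → ℂ | (∀ i, ‖z i - θ i‖ ≤ Real.exp (-R N)) ∧
              ∀ j, aeval z (Q N j) = 0} ∧
          (∀ j, ((Q N j).totalDegree : ℝ) ≤ δ N) ∧
          (∀ j, Real.log (Literature.NumberTheory.Transcendental.Chudnovsky.l1 (Q N j)) ≤ σ N) ∧
          (∃ j, aeval θ (Q N j) ≠ 0) ∧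
          (∀ j, ‖aeval θ (Q N j)‖ ≤ Real.exp (-S N))) →
        (((k + 1 : ℕ)) : Cardinal) ≤ Algebra.trdeg ℚ ↥(IntermediateField.adjoin ℚ (Set.range θ)) := by
  classical
  by_cases htr : Algebra.trdeg ℚ ↥(IntermediateField.adjoin ℚ (Set.range θ)) ≤ k
  swap
  · -- nothing to prove: `trdeg > k`
    refine ⟨1, le_rfl, ?_⟩
    intros
    by_contra h
    exact htr (trdeg_le_of_not_le θ h)
  -- the constants of `θ`: rank, degree and height of the starting prime
  obtain ⟨ω, hω⟩ : ∃ ω : Fin (n + 1) → ℂ, ω = Fin.cons 1 θ := ⟨_, rfl⟩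
  obtain ⟨r₀, hr₀⟩ : ∃ r₀ : ℕ, r₀ = Classical.choose (exists_isUnmixedOfRank_coneIdeal θ htr) := ⟨_, rfl⟩
  have hr₀spec := Classical.choose_spec (exists_isUnmixedOfRank_coneIdeal θ htr)
  have hr₀1 : 1 ≤ r₀ := by rw [hr₀]; exact hr₀spec.1
  have hr₀k : r₀ ≤ k + 1 := by rw [hr₀]; exact hr₀spec.2.1
  obtain ⟨D₀, hD₀⟩ : ∃ D₀ : ℕ, D₀ = max (ideg (coneIdeal ω) r₀) 1 := ⟨_, rfl⟩
  obtain ⟨H₀, hH₀⟩ : ∃ H₀ : ℝ, H₀ = iheight (coneIdeal ω) r₀ := ⟨_, rfl⟩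
  obtain ⟨cB, hcB⟩ : ∃ cB : ℝ, cB = 1 + (n : ℝ) * (k + 2) + (n : ℝ) ^ 2 := ⟨_, rfl⟩
  obtain ⟨B1, hB1⟩ : ∃ B1 : ℝ, B1 = H₀ + ((r₀ - 1 : ℕ) : ℝ) * D₀ * cB := ⟨_, rfl⟩
  obtain ⟨Θ, hΘ⟩ : ∃ Θ : ℝ, Θ = ‖ω‖ := ⟨_, rfl⟩
  obtain ⟨c, hc⟩ : ∃ c : ℝ, c = 20 * ((1 + (n : ℝ) ^ 2) * (2 + n * (k + 3))) := ⟨_, rfl⟩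
  obtain ⟨q, hq⟩ : ∃ q : ℝ, q = 1 / (c * (1 + B1 + D₀)) := ⟨_, rfl⟩
  have hn1 : (1 : ℝ) ≤ n := by exact_mod_cast (show 1 ≤ n by omega)
  have hH₀0 : 0 ≤ H₀ := by rw [hH₀]; exact height_nonneg _
  have hD₀1 : (1 : ℝ) ≤ D₀ := by rw [hD₀]; exact_mod_cast le_max_right _ _
  have hD₀0 : (0 : ℝ) ≤ D₀ := by linarith
  have hcB1 : 1 ≤ cB := by rw [hcB]; nlinarith [sq_nonneg (n : ℝ)]
  have hB10 : 0 ≤ B1 := by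
    rw [hB1]
    exact add_nonneg hH₀0 (mul_nonneg (mul_nonneg (Nat.cast_nonneg _) hD₀0) (by linarith))
  have hc1 : 40 ≤ c := by
    rw [hc]
    have h1 : (1 : ℝ) ≤ 1 + (n : ℝ) ^ 2 := by nlinarith
    have h2 : (2 : ℝ) ≤ 2 + n * (k + 3) := by
      have : (0 : ℝ) ≤ n * (k + 3) := by positivity
      linarith
    nlinarith [mul_le_mul h1 h2 (by norm_num) (by positivity)]
  have hc0 : 0 < c := by linarith
  have hden : 1 ≤ c * (1 + B1 + D₀) := one_le_mul_of_one_le_of_one_le (by linarith) (by linarith)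
  have hden0 : 0 < c * (1 + B1 + D₀) := by linarith
  have hq0 : 0 < q := by rw [hq]; exact div_pos one_pos hden0
  have hq1 : q ≤ 1 := by rw [hq, div_le_one hden0]; exact hden
  have hqc : c * q * (1 + B1 + D₀) = 1 := by
    have h1 : c ≠ 0 := hc0.ne'
    have h2 : (1 + B1 + D₀) ≠ 0 := ne_of_gt (by linarith)
    rw [hq]; field_simp
  have hqp : 0 < q ^ (r₀ - 1) := pow_pos hq0 _
  have hΘ1 : 1 ≤ Θ := by rw [hΘ, hω]; exact one_le_norm_cons_one θ
  -- the eight thresholds and `C`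
  obtain ⟨t₁, ht₁⟩ : ∃ t₁ : ℝ, t₁ = (2 + 8 * r₀ * (n : ℝ) ^ 3) / q ^ (r₀ - 1) := ⟨_, rfl⟩
  obtain ⟨t₂, ht₂⟩ : ∃ t₂ : ℝ, t₂ = 2 * (1 + 11 * (n : ℝ) ^ 2) / q ^ (r₀ - 1) := ⟨_, rfl⟩
  obtain ⟨t₃, ht₃⟩ : ∃ t₃ : ℝ, t₃ = 10 * (1 + 12 * (n : ℝ) ^ 2) / q ^ (r₀ - 1) := ⟨_, rfl⟩
  obtain ⟨t₄, ht₄⟩ : ∃ t₄ : ℝ, t₄ = 20 * (n : ℝ) ^ 3 / q ^ (r₀ - 1) := ⟨_, rfl⟩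
  obtain ⟨t₅, ht₅⟩ : ∃ t₅ : ℝ, t₅ = 2 * (1 + 11 * (n : ℝ) ^ 2) * (B1 + D₀) := ⟨_, rfl⟩
  obtain ⟨t₆, ht₆⟩ : ∃ t₆ : ℝ, t₆ = 2 * (n : ℝ) := ⟨_, rfl⟩
  obtain ⟨t₇, ht₇⟩ : ∃ t₇ : ℝ, t₇ = log (4 * Θ ^ 2) := ⟨_, rfl⟩
  obtain ⟨t₈, ht₈⟩ : ∃ t₈ : ℝ, t₈ = 20 * (n : ℝ) ^ 3 * D₀ := ⟨_, rfl⟩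
  have h₁ : 0 ≤ t₁ := by rw [ht₁]; exact div_nonneg (by positivity) hqp.le
  have h₂ : 0 ≤ t₂ := by rw [ht₂]; exact div_nonneg (by positivity) hqp.le
  have h₃ : 0 ≤ t₃ := by rw [ht₃]; exact div_nonneg (by positivity) hqp.le
  have h₄ : 0 ≤ t₄ := by rw [ht₄]; exact div_nonneg (by positivity) hqp.le
  have h₅ : 0 ≤ t₅ := by rw [ht₅]; exact mul_nonneg (by positivity) (by linarith)
  have h₆ : 0 ≤ t₆ := by rw [ht₆]; positivity
  have h₇ : 0 ≤ t₇ := by rw [ht₇]; exact log_nonneg (by nlinarith)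
  have h₈ : 0 ≤ t₈ := by rw [ht₈]; exact mul_nonneg (by positivity) hD₀0
  obtain ⟨C, hCdef⟩ : ∃ C : ℝ, C = 1 + t₁ + t₂ + t₃ + t₄ + t₅ + t₆ + t₇ + t₈ := ⟨_, rfl⟩
  have hC1 : 1 ≤ C := by rw [hCdef]; linarith
  refine ⟨C, hC1, ?_⟩
  intro σ δ R S hσ hδ hR hS h1σ h1δ h1R h1S hτ hmono hgrowth N₀ mN Q hQ
  exfalso
  -- the standing data and its constants
  obtain ⟨𝒮, e_m, e_k, e_C, e_N₀, e_R, e_τ, e_r₀, e_D₀, e_H₀, e_Θ⟩ :=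
    exists_setup θ hkn htr hC1 σ δ R S hσ hδ hR hS h1σ h1δ h1R h1S hτ hmono hgrowth N₀ mN Q hQ
  rw [← hr₀] at e_r₀ e_D₀ e_H₀
  rw [← hω] at e_D₀ e_H₀ e_Θ
  rw [← hD₀] at e_D₀
  rw [← hH₀] at e_H₀
  rw [← hΘ] at e_Θ
  have e_mR : (𝒮.m : ℝ) = n := by rw [e_m]
  have e_kR : (𝒮.k : ℝ) = k := by rw [e_k]
  have e_B1 : 𝒮.B 1 = B1 := by
    show 𝒮.H₀ + ((𝒮.r₀ - 1 : ℕ) : ℝ) * 𝒮.D₀ * 𝒮.cB = B1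
    rw [e_H₀, e_r₀, e_D₀, hB1]
    congr 1
    show ((r₀ - 1 : ℕ) : ℝ) * D₀ * (1 + (𝒮.m : ℝ) * (𝒮.k + 2) + (𝒮.m : ℝ) ^ 2) = _
    rw [e_mR, e_kR, hcB]
  have hr₀m : 𝒮.r₀ ≤ 𝒮.m := by rw [e_r₀, e_m]; omega
  -- the level `N₁`
  have hκ : 𝒮.κ = 1 / (4 * Θ ^ 2) := by show 1 / (4 * 𝒮.Θ ^ 2) = _; rw [e_Θ]
  obtain ⟨a, ha⟩ : ∃ a : ℝ, a = q ^ (r₀ - 1) * C / (2 * r₀) := ⟨_, rfl⟩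
  have hCpos : 0 < C := by linarith
  have hr₀pos : (0 : ℝ) < r₀ := by exact_mod_cast hr₀1
  have ha0 : 0 < a := by rw [ha]; exact div_pos (mul_pos hqp hCpos) (by linarith)
  have hev : ∀ᶠ N in atTop, 𝒮.R 𝒮.N₀ + log (1 / 𝒮.κ) < a * (σ N + δ N) :=
    (hτ.const_mul_atTop ha0).eventually_gt_atTop _
  obtain ⟨N₁', hN₁'⟩ := eventually_atTop.mp hev
  refine 𝒮.not_large h44 h47 h410 h411 h412 h413 hr₀m hq0 hq1 ?_ ?_ ?_ ?_ ?_ ?_ ?_ ?_ ?_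
    (N₁ := max 𝒮.N₀ N₁') (le_max_left _ _) ?_
  · rw [e_mR, e_kR, e_B1, e_D₀, ← hc, hqc]
  · rw [e_r₀, e_mR, e_C]
    have : t₁ ≤ C := by rw [hCdef]; linarith
    rw [ht₁, div_le_iff₀ hqp] at this; linarith
  · rw [e_r₀, e_mR, e_C]
    have : t₂ ≤ C := by rw [hCdef]; linarith
    rw [ht₂, div_le_iff₀ hqp] at this; linarith
  · rw [e_r₀, e_mR, e_C]
    have : t₃ ≤ C := by rw [hCdef]; linarith
    rw [ht₃, div_le_iff₀ hqp] at this; linarith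
  · rw [e_r₀, e_mR, e_C]
    have : t₄ ≤ C := by rw [hCdef]; linarith
    rw [ht₄, div_le_iff₀ hqp] at this; linarith
  · rw [e_mR, e_B1, e_D₀, e_C]
    have : t₅ ≤ C := by rw [hCdef]; linarith
    rw [ht₅] at this; exact this
  · rw [e_mR, e_C]
    have : t₆ ≤ C := by rw [hCdef]; linarith
    rw [ht₆] at this; exact this
  · rw [e_Θ, e_C]
    have : t₇ ≤ C := by rw [hCdef]; linarith
    rw [ht₇] at this; exact this
  · rw [e_mR, e_D₀, e_C]
    have : t₈ ≤ C := by rw [hCdef]; linarith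
    rw [ht₈] at this; exact this
  · intro N hN
    have h := hN₁' N (le_trans (le_max_right _ _) hN)
    rw [e_r₀, e_C, e_τ]
    rw [ha] at h
    convert h using 1
    ring

end PhilipponMain

end Literature.NumberTheory.Transcendental

end
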